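import Summits.QuantumFields.BalabanUV.T4Continuum.Spine.NE3.TangentProjectionSlicB8
import Summits.QuantumFields.BalabanUV.T4Continuum.Support.NE3FrameFreeDecompositionW
import HarnessLib

/-!
# T⁴ programme, node NE3 — census R42 (a): THE KERNEL OF THE k-FOLD LINEARISED DOUBLE-BAR AVERAGE SPLITS AS
# `T_♮(W) ⊕ gaugeDir W (N(Q′(W)))` — every skew periodic `Y` with `QbarIter L (j+1) W Y = 0` is moved INTO the owner swarm's curved
# frame-free slice `frameFreeBlockLandauW L N (j+1) W` by the gauge direction of a generator `λ ∈ N(Q′(W)) = avgKernelGauges L N (j+1) W`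

Cell `pub-balaban-gaps` (YM blitz, track G2, seat `ne3`, unit `pub-balaban-gaps-ne3-g10`; writer prover-pub-balaban-gaps-ne3-g10-0, 2026-08-25), census
`run/shared/lean/pub/pub-balaban-gaps/ne/NE3.md` §4 R42 ∕ §16.  WHY.  THE END on B8's surface (`PairLandauB8EndSfClassH3sup`) keeps ONE [B9]-§3-TYPE binder,
`hP` = (P♮) on `slicB8 L N (j+1) W` at the CURVED background `W = cavg L U_B`.  The owner swarm PROVED the curved (P♮) on ITS slice of record
`T_♮(W) = NE3FrameFreeSliceW.frameFreeBlockLandauW` (`NE3SlicePoincareCurved.slicePoincare_frameFreeBlockLandauW`, class form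
`NE3ClassSlicePoincare.classSlicePoincare_of_lines`).  To TRANSFER a slice Poincaré inequality from `T_♮(W)` to a Landau-type slice one needs the two slices
to be complements of the SAME gauge sub-orbit inside the SAME ambient space.  THIS FILE supplies the ambient decomposition: the kernel of the k-fold
linearised double-bar average `QbarIter L (j+1) W` (skew, periodic directions) is `T_♮(W) + gaugeDir W (N(Q′(W)))`, with `N(Q′(W)) = avgKernelGauges`
(skew, periodic, NESTED TRANSPORTED BLOCK MEAN ZERO — B8's restricted gauge algebra of (1.38), `Spine/NE3/PairLandauB8`).

MECHANISM.  (i) R25's corner spike `ζ` of the accumulated frames `f = framePotW L (j+1) W Y` makes `Y − gaugeDir W ζ` tangent to the PLAIN fibre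
(`TangentProjectionSlicB8.tangentIter_sub_gaugeDir_of_QbarIter_eq_zero`); (ii) the owner swarm's (E_W) `NE3FrameFreeDecompositionW.exists_cornerGauge_mem_frameFreeBlockLandauW`
moves a plain-tangent direction into `T_♮(W)` by a CORNER-TRIVIAL generator `μ`; (iii) the total generator `λ = μ − ζ` has corner values `−f`, and the
curved identity (‡) `NE3CovariantBlockMean.framePotW_gaugeDir` (`framePotW (gaugeDir W λ) z = λ(L^{j+1}z) − bmeanIterW λ z`) turns the FRAME-FREENESS of
`Y + gaugeDir W λ` into `bmeanIterW L (j+1) W λ = 0`, i.e. `λ ∈ N(Q′(W))` — for free.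

CONTENT (0 sorry, no `def`): **`exists_avgKernelGauge_mem_frameFreeBlockLandauW`** [folklore] — at every unitary `(N·L^{j+1})`-periodic background of the
tower's small-field class (`0 ≤ x`, `LevelSmall d L j x`, `SmallField W x`; `L ≥ 1`, `L^d ≥ 2`), every skew periodic `Y` with `QbarIter L (j+1) W Y = 0`
has `λ ∈ avgKernelGauges L N (j+1) W` with `λ (L^{j+1}•z) = −framePotW L (j+1) W Y z` and `Y + gaugeDir W λ ∈ frameFreeBlockLandauW L N (j+1) W`.

HONEST FRAMING.  Exact kinematics ∕ linear algebra of OUR linearised averaging at one background of the class (owner swarm's K0 rows + this seat's R25,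
BY NAME); nothing of Bałaban's asserted; (P♮) on `slicB8`, the covariant root and **NE3 are NOT proved**; spine PROVED 0∕9; finite T⁴ rung (B)+1 — NOT
continuum YM on ℝ⁴, NOT infinite volume, NOT mass gap, NOT Clay.  PLACEMENT: `Summits/QuantumFields/BalabanUV/T4Continuum/Spine/NE3/`; imports accepted
modules only; moves nothing.
-/

set_option autoImplicit false

open scoped BigOperators Matrix Matrix.Norms.L2Operator
open Finset

namespace Summit.QuantumFields.BalabanUV.T4Continuum.NE3.AvgKernelGaugeDecomposition

open Literature.MathematicalPhysics.QuantumFieldTheory.Balaban1983to89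
open B7Prop1Explicit B7Prop2Explicit
open T4AveragingDeficitWall (IsUnitaryCfg IsSkewDir SmallField Ad)
open T4AveragingDeficitWallBoundary (IsPeriodicCfg periodBox mem_periodBox)
open AveragingDeficitPeriodicCounting (IsPeriodicDir)
open AveragingDeficitMultiLevelPrep (TangentIter tower LevelSmall)
open BlockAveragePushDirGauge (gaugeDir isPeriodicDir_gaugeDir)
open NE3TangentCovariantStructure (gaugeDir_add_fun)
open NE3TangentCovariantTower (QbarIter framePotW)
open NE3CovariantBlockMean (bmeanIterW framePotW_gaugeDir)
open NE3CurvedFrameKill (framePotW_add framePotW_skew_periodic)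
open NE3LandauOrbit (gaugeDir_skew)
open NE3FramePotBoundW (tower_eq_pow_mul)
open NE3FrameFreeSliceW (frameFreeBlockLandauW)
open NE3FrameFreeDecompositionW (exists_cornerGauge_mem_frameFreeBlockLandauW gaugeDir_sub_fun)
open NE3.PairLandauB8 (avgKernelGauges mem_avgKernelGauges_iff)
open NE3.TangentProjectionSlicB8 (tangentIter_sub_gaugeDir_of_QbarIter_eq_zero)

noncomputable section

variable {d : ℕ} {n : Type*} [Fintype n] [DecidableEq n]

/-- **THE KERNEL OF THE k-FOLD LINEARISED DOUBLE-BAR AVERAGE IS `T_♮(W) + gaugeDir W (N(Q′(W)))`** (unitary `W` of period `N·L^{j+1}` in the tower's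
small-field class — `0 ≤ x`, `LevelSmall d L j x`, `SmallField W x`; `1 ≤ L`, `2 ≤ L^d`): every skew `(N·L^{j+1})`-periodic `Y` with
`QbarIter L (j+1) W Y = 0` has a generator `λ ∈ avgKernelGauges L N (j+1) W` (skew, periodic, `bmeanIterW L (j+1) W λ = 0`) with corner values
`λ (L^{j+1}•z) = −framePotW L (j+1) W Y z` such that `Y + gaugeDir W λ ∈ frameFreeBlockLandauW L N (j+1) W`.  Corner spike (R25) ∘ (E_W) ∘ (‡). [folklore] -/
theorem exists_avgKernelGauge_mem_frameFreeBlockLandauW [Nonempty n] {L N : ℕ} [NeZero N] (hL : 1 ≤ L) (hLd : 2 ≤ L ^ d) (j : ℕ)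
    {W : Site d → Fin d → (Matrix n n ℂ)ˣ} {x : ℝ} (hWu : IsUnitaryCfg W) (hWP : IsPeriodicCfg W ((N * L ^ (j + 1) : ℕ) : ℤ))
    (hx : 0 ≤ x) (hs : LevelSmall d L j x) (hWx : SmallField W x) {Y : Site d → Fin d → Matrix n n ℂ} (hYs : IsSkewDir Y)
    (hYP : IsPeriodicDir Y ((N * L ^ (j + 1) : ℕ) : ℤ)) (hQ : QbarIter L (j + 1) W Y = fun _ _ => 0) :
    ∃ lam : Site d → Matrix n n ℂ, lam ∈ avgKernelGauges (d := d) (n := n) L N (j + 1) W ∧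
      (∀ z : Site d, lam (((L : ℤ) ^ (j + 1)) • z) = -framePotW L (j + 1) W Y z) ∧
      (fun y ν => Y y ν + gaugeDir W lam y ν) ∈ frameFreeBlockLandauW (d := d) (n := n) L N (j + 1) W := by
  set M : ℕ := L ^ (j + 1) with hM
  have hMpos : 0 < M := by rw [hM]; positivity
  have hM0 : (M : ℤ) ≠ 0 := by exact_mod_cast hMpos.ne'
  have hMZ : ((M : ℕ) : ℤ) = (L : ℤ) ^ (j + 1) := by rw [hM]; push_cast; rfl
  have htower : tower L N (j + 1) = M * N := by rw [tower_eq_pow_mul]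
  have hNM : N * M = M * N := Nat.mul_comm _ _
  -- periodicity in the forms the tree's lemmas want
  have hWP_MN : IsPeriodicCfg W ((M * N : ℕ) : ℤ) := by rw [← hNM]; exact hWP
  have hYP_MN : IsPeriodicDir Y ((M * N : ℕ) : ℤ) := by rw [← hNM]; exact hYP
  have hWP_T : IsPeriodicCfg W ((tower L N (j + 1) : ℕ) : ℤ) := by rw [htower]; exact hWP_MN
  have hYP_T : IsPeriodicDir Y ((tower L N (j + 1) : ℕ) : ℤ) := by rw [htower]; exact hYP_MN
  -- the accumulated frames: skew and `N`-periodic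
  obtain ⟨hfs, hfP⟩ := framePotW_skew_periodic (M := N) hL j hWu hWP_T hx hs hWx hYs hYP_T
  -- (i) the corner spike of the accumulated frames (R25)
  set f : Site d → Matrix n n ℂ := framePotW L (j + 1) W Y with hf
  set ζ : Site d → Matrix n n ℂ := fun y => if (∀ i, (M : ℤ) ∣ y i) then f (fun i => y i / (M : ℤ)) else 0 with hζ
  have hζ_of : ∀ y : Site d, (∀ i, (M : ℤ) ∣ y i) → ζ y = f (fun i => y i / (M : ℤ)) := fun y h => by
    simp only [hζ, if_pos h]
  have hζ_off : ∀ y : Site d, ¬ (∀ i, (M : ℤ) ∣ y i) → ζ y = 0 := fun y h => by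
    simp only [hζ, if_neg h]
  have hcorner : ∀ z : Site d, ζ ((M : ℤ) • z) = f z := by
    intro z
    have hdiv : ∀ i, (M : ℤ) ∣ ((M : ℤ) • z) i := fun i => by
      simp only [Pi.smul_apply, smul_eq_mul]; exact dvd_mul_right _ _
    rw [hζ_of _ hdiv]
    congr 1
    funext i
    simp only [Pi.smul_apply, smul_eq_mul]
    exact Int.mul_ediv_cancel_left _ hM0
  have hcorner' : ∀ z : Site d, ζ (((L : ℤ) ^ (j + 1)) • z) = framePotW L (j + 1) W Y z := by
    intro z; rw [← hMZ]; exact hcorner z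
  have hζs : ∀ y, ζ y ∈ skewAdjoint (Matrix n n ℂ) := by
    intro y
    by_cases hdiv : ∀ i, (M : ℤ) ∣ y i
    · rw [hζ_of y hdiv]; exact hfs _
    · rw [hζ_off y hdiv]; exact (skewAdjoint (Matrix n n ℂ)).zero_mem
  have hζP : ∀ (y : Site d) (i : Fin d), ζ (y + ((M * N : ℕ) : ℤ) • e i) = ζ y := by
    intro y i
    have hcoord : ∀ k : Fin d, (y + ((M * N : ℕ) : ℤ) • e i) k = y k + (M : ℤ) * ((N : ℤ) * e i k) := by
      intro k; simp only [Pi.add_apply, Pi.smul_apply, smul_eq_mul]; push_cast; ring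
    have hdiv_iff : (∀ k, (M : ℤ) ∣ (y + ((M * N : ℕ) : ℤ) • e i) k) ↔ ∀ k, (M : ℤ) ∣ y k := by
      refine forall_congr' fun k => ?_
      rw [hcoord]
      constructor
      · intro h
        have h' := dvd_sub h (dvd_mul_right (M : ℤ) ((N : ℤ) * e i k))
        rwa [add_sub_cancel_right] at h'
      · intro h
        exact dvd_add h (dvd_mul_right _ _)
    by_cases hdiv : ∀ k, (M : ℤ) ∣ y k
    · rw [hζ_of _ (hdiv_iff.mpr hdiv), hζ_of _ hdiv]
      have hq : (fun k => (y + ((M * N : ℕ) : ℤ) • e i) k / (M : ℤ)) = (fun k => y k / (M : ℤ)) + (N : ℤ) • e i := by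
        funext k
        rw [hcoord, Int.add_mul_ediv_left _ _ hM0]
        simp only [Pi.add_apply, Pi.smul_apply, smul_eq_mul]
      rw [hq, hfP]
    · rw [hζ_off _ hdiv, hζ_off _ (fun h => hdiv (hdiv_iff.mp h))]
  have hζP_T : ∀ (y : Site d) (i : Fin d), ζ (y + ((tower L N (j + 1) : ℕ) : ℤ) • e i) = ζ y := by rw [htower]; exact hζP
  -- the plain-tangent direction `Y₁ = Y − gaugeDir W ζ`
  set Y₁ : Site d → Fin d → Matrix n n ℂ := fun y ν => Y y ν - gaugeDir W ζ y ν with hY₁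
  have hT₁ : TangentIter L j W Y₁ :=
    tangentIter_sub_gaugeDir_of_QbarIter_eq_zero hL j hWu hWP_T hx hs hWx hYs hYP_T hQ hζs hζP_T hcorner'
  have hY₁s : IsSkewDir Y₁ := fun y ν => (skewAdjoint _).sub_mem (hYs y ν) (gaugeDir_skew hWu hζs y ν)
  have hY₁P : IsPeriodicDir Y₁ ((tower L N (j + 1) : ℕ) : ℤ) := by
    have hGP : IsPeriodicDir (gaugeDir W ζ) ((tower L N (j + 1) : ℕ) : ℤ) := isPeriodicDir_gaugeDir hWP_T hζP_T
    intro y i ν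
    simp only [hY₁, hYP_T y i ν, hGP y i ν]
  -- (ii) the owner swarm's (E_W): a corner-trivial `μ` moving `Y₁` into `T_♮(W)`
  obtain ⟨mu, hmus, hmuP, hmu0, hX⟩ :=
    exists_cornerGauge_mem_frameFreeBlockLandauW (M := N) hL hLd j hWu hWP_T hx hs hWx hY₁s hY₁P hT₁
  -- (iii) the total generator `λ = μ − ζ`
  refine ⟨fun y => mu y - ζ y, ?_, fun z => by show mu _ - ζ _ = _; rw [hmu0 z, hcorner' z, zero_sub, hf], ?_⟩
  · -- `λ ∈ N(Q′(W))`: skew, periodic, and nested mean zero BY FRAME-FREENESS through (‡)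
    have hlams : ∀ y, (fun y => mu y - ζ y) y ∈ skewAdjoint (Matrix n n ℂ) := fun y => (skewAdjoint _).sub_mem (hmus y) (hζs y)
    have hlamP_T : ∀ (y : Site d) (i : Fin d), (fun y => mu y - ζ y) (y + ((tower L N (j + 1) : ℕ) : ℤ) • e i) = (fun y => mu y - ζ y) y := by
      intro y i; simp only [hmuP y i, hζP_T y i]
    refine mem_avgKernelGauges_iff.mpr ⟨hlams, ?_, ?_⟩
    · intro y i
      have h := hlamP_T y i
      rw [htower, ← hNM] at h
      simpa [hM] using h
    · -- frame-freeness of `X = Y₁ + gaugeDir W μ = Y + gaugeDir W λ` and the curved (‡)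
      have hFX := hX.2.2.2.1
      funext z
      have hsplit : (fun y ν => Y₁ y ν + gaugeDir W mu y ν) = fun y ν => Y y ν + gaugeDir W (fun y => mu y - ζ y) y ν := by
        funext y ν; simp only [hY₁, gaugeDir_sub_fun]; abel
      have h0 := hFX z
      rw [hsplit, framePotW_add hL j hWu hx hs hWx Y (gaugeDir W fun y => mu y - ζ y) z,
        framePotW_gaugeDir (M := N) hL j hWu hWP_T hx hs hWx hlams hlamP_T z] at h0
      simp only [hmu0 z, hcorner' z, zero_sub, ← hf] at h0
      -- `h0 : f z + (−f z − bmeanIterW … z) = 0`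
      have : bmeanIterW L (j + 1) W (fun y => mu y - ζ y) z = 0 := by
        have h1 : f z + (-f z - bmeanIterW L (j + 1) W (fun y => mu y - ζ y) z) = -bmeanIterW L (j + 1) W (fun y => mu y - ζ y) z := by abel
        rw [h1] at h0
        exact neg_eq_zero.mp h0
      simpa using this
  · -- the direction: `Y + gaugeDir W λ = Y₁ + gaugeDir W μ ∈ T_♮(W)`
    have hsplit : (fun y ν => Y y ν + gaugeDir W (fun y => mu y - ζ y) y ν) = fun y ν => Y₁ y ν + gaugeDir W mu y ν := by
      funext y ν; simp only [hY₁, gaugeDir_sub_fun]; abel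
    rw [hsplit]; exact hX

end

end Summit.QuantumFields.BalabanUV.T4Continuum.NE3.AvgKernelGaugeDecomposition
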